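import Literature.Geometry.Riemannian.VolumeSphereTheorem
import Mathlib.Geometry.Manifold.Riemannian.PathELength
import Mathlib.Analysis.InnerProductSpace.EuclideanDist
import Mathlib.Geometry.Euclidean.Angle.Unoriented.Basic
import HarnessLib

/-!
# Cheeger–Colding's volume sphere theorem A.1.10 = Colding's "volume ⟹ Gromov–Hausdorff close to
  `Sⁿ`" + Cheeger–Colding's sphere stability A.1.12: the decomposition

Librarian fact-decomposition (libsplit-27, 2026-08-16) of the capped named fact
`Literature.Geometry.Riemannian.CheegerColding1997_thmA110` (`VolumeSphereTheorem.lean`: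
Cheeger–Colding, J. Differential Geom. 46 (1997), Appendix 1, **Thm A.1.10**, p. 459: "There exists
`δ(n) > 0`, such that if `Ric_{Mⁿ} ≥ n - 1`, `Vol(Mⁿ) ≥ (1 - δ(n)) Vol(Sⁿ)`, then `Mⁿ` is
diffeomorphic to `Sⁿ`"). The printed proof is one sentence (p. 459): "By arguing as in [24], [25]
(see also [15, Section 5]) but letting Theorem A.1.8 play the role of Perelman's theorem, we obtain
the following differentiable sphere theorem", i.e. it composes two theorems printed elsewhere:

1. **Colding, *Shape of manifolds with positive Ricci curvature*, Invent. Math. 124 (1996)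
   175–191 ([24]), Main Theorem** (Zbl 0871.53027): "Given an integer `n ≥ 2` and `ε > 0`, there
   exists `δ = δ(n, ε) > 0` such that if `M` is an `n`-dimensional closed Riemannian manifold with
   `Ric ≥ n - 1` and `Vol(M) ≥ Vol(Sⁿ) − δ`, then the Gromov–Hausdorff distance between `M` and `Sⁿ`
   is at most `ε`" — vendored as `Colding1996_volume_ghClose`;
2. **Cheeger–Colding 1997, Thm A.1.12** (p. 459, "a sharpening of the statement of Gromov's
   conjecture proved in [26]"): "Let the compact smooth Riemannian manifold `Mⁿ` be the
   Gromov–Hausdorff limit of a sequence `{M_iⁿ}` satisfying (1.1) [`Ric_{M_iⁿ} ≥ −(n−1)`]. Then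
   `M_iⁿ` is diffeomorphic to `Mⁿ`, for all `i` sufficiently large" — at `Mⁿ = Sⁿ` the unit round
   sphere and in the (equivalent, by contradiction along `ε = 1/i`) `ε`-form: there is `ε(n) > 0`
   such that every closed `Mⁿ` with `Ric ≥ −(n−1)` within Gromov–Hausdorff distance `ε` of the round
   `Sⁿ` is diffeomorphic to `Sⁿ` — vendored as `CheegerColding1997_sphereStability`.

Both are named facts (`def … : Prop`, not proved here: (1) is Colding's `L²`-Toponogov / almost
rigidity theory on top of Bishop–Gromov and the segment inequality; (2) is the intrinsic Reifenberg
method, Thms A.1.1–A.1.3 and A.1.8–A.1.9, with Colding's volume convergence Thm A.1.5 = [26] — the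
comparison-geometry, measure and one-variable layers of which the fact's seat has begun in
`VolumeSphereTheoremProofs.lean`, `…ReifenbergProofs.lean`, `…JacobiFrameProofs.lean`), and the
assembly `CheegerColding1997_thmA110_holds_of : child₁ → child₂ → CheegerColding1997_thmA110` is
PROVED (take `ε` from (2), then `δ` from (1) at that `ε`; `Ric ≥ n − 1 ≥ −(n − 1)` as `h ≥ 0`).

## The notion: Gromov–Hausdorff closeness of `(M, d_h)` to the round sphere

"`d_GH(M, Sⁿ) ≤ ε`" is rendered through the working notion of the subject (Colding 1997 *Aspects*,
Def. 2.1 and the remark after it; the tree's `Literature.Geometry.MetricGeometry.IsGHApprox`): an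
**`ε`-Gromov–Hausdorff approximation** `f : M → Sⁿ`, i.e. a map with distortion
`|d_{Sⁿ}(f a, f b) − d_h(a, b)| ≤ ε` and `ε`-dense image, where `d_h = Manifold.riemannianEDist` is
Mathlib's length distance of the Riemannian metric `h` (the infimum of lengths of `C¹` paths, finite
on a connected manifold; the same distance whose Hausdorff measure is the parent's
`riemannianMeasure h`) and `d_{Sⁿ}(x, y) = ∠(x, y) = arccos ⟪x, y⟫` is the INTRINSIC (great-circle)
distance of the unit round sphere (Mathlib's `InnerProductGeometry.angle` of the two unit vectors) —
NOT the chordal distance of the subtype `Metric.sphere 0 1 ⊂ ℝⁿ⁺¹`, which is why `IsGHApprox` (which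
would read the chordal `dist`) is not used verbatim. This is `IsRoundSphereGHApprox n h ε f`. For
compact spaces an `ε`-approximation gives `d_GH ≤ 3ε/2` and `d_GH < ε` gives a `2ε`-approximation
(`IsGHApprox.ghDist_le`, `exists_isGHApprox_of_ghDist_lt`), so up to these constants — absorbed by the
quantifiers `∀ ε ∃ δ` / `∃ ε` — the renderings are equivalent to the printed `d_GH`-statements.

## Faithfulness

* Child 1 renders "`Vol(M) ≥ Vol(Sⁿ) − δ`" as "`Vol(M) ≥ (1 − δ)|Sⁿ|`" (the parent's form; the two
  are interchangeable, `|Sⁿ| > 0` depending on `n` only) and "`d_GH ≤ ε`" as "there is an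
  `ε`-approximation `M → Sⁿ`" (implied by print at `ε/3`). Hypotheses as in the parent: compact
  (hence complete) connected `C^∞` manifolds, `n ≥ 2` — the printed "closed".
* Child 2 keeps the printed curvature hypothesis (1.1), `Ric ≥ −(n − 1)`, and is the `ε`-form of
  Thm A.1.12 at the round sphere; the diffeomorphism is `C^∞`, as in the parent.
* Neither child restates the parent: (1) has a metric conclusion and no topology, (2) has a metric
  hypothesis and no volume.

## References

* J. Cheeger, T. H. Colding, *On the structure of spaces with Ricci curvature bounded below. I*,
  J. Differential Geom. 46 (1997) 406–480: Appendix 1, Thm A.1.10 and the sentence before it, Thm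
  A.1.12 (p. 459); (1.1); references [15], [24]–[26], [46]. Read: `lit read
  doi:10.4310/jdg/1214459974`, pp. 458–460, 479–480. [CheegerColding1997]
* T. H. Colding, *Shape of manifolds with positive Ricci curvature*, Invent. Math. 124 (1996)
  175–191, Main Theorem (Zbl 0871.53027, review by C. Bär). [Colding1996Shape]
* T. H. Colding, *Large manifolds with positive Ricci curvature*, Invent. Math. 124 (1996) 193–214,
  Thm A / Cor. B (the converse direction and the homeomorphism; context).
* T. H. Colding, *Ricci curvature and volume convergence*, Ann. of Math. 145 (1997) 477–501
  (= Thm A.1.5). [Colding1997]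
* T. H. Colding, *Aspects of Ricci curvature*, in: Comparison Geometry, MSRI Publ. 30 (1997), Def.
  2.1 (`ε`-Gromov–Hausdorff approximations). [Colding1997Aspects]
* G. Perelman, *Manifolds of positive Ricci curvature with almost maximal volume*, J. Amer. Math.
  Soc. 7 (1994) 299–305. [Perelman1994]
-/

noncomputable section

open scoped Manifold ContDiff ENNReal

namespace Literature.Geometry.Riemannian

open Literature.Geometry.Lorentzian (PseudoRiemannianMetric riemannianMeasure)

/-- **`ε`-Gromov–Hausdorff approximation from a Riemannian manifold to the unit round sphere.**
For a `C^∞` Riemannian metric `h` on the `n`-manifold `M` (length distance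
`d_h = Manifold.riemannianEDist`, Mathlib) and `f : M → Sⁿ ⊂ ℝⁿ⁺¹`: `f` distorts distances by at
most `ε` against the INTRINSIC distance `∠(x, y) = arccos ⟪x, y⟫` of the round sphere
(`InnerProductGeometry.angle` of unit vectors), `|∠(f a, f b) − d_h(a, b)| ≤ ε`, and has `ε`-dense
image. The working form of "`d_GH((M, d_h), Sⁿ) ≲ ε`" (Colding 1997, *Aspects*, Def. 2.1; the
tree's `MetricGeometry.IsGHApprox`, here with the great-circle rather than the chordal distance on
the sphere). [cite: Colding1997Aspects, Def. 2.1 and the remark following it] -/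
def IsRoundSphereGHApprox (n : ℕ) {M : Type} [TopologicalSpace M]
    [ChartedSpace (EuclideanSpace ℝ (Fin n)) M] [IsManifold (𝓡 n) ∞ M]
    (h : Bundle.ContMDiffRiemannianMetric (𝓡 n) ∞ (EuclideanSpace ℝ (Fin n))
      (TangentSpace (𝓡 n) : M → Type _))
    (ε : ℝ) (f : M → Metric.sphere (0 : EuclideanSpace ℝ (Fin (n + 1))) 1) : Prop :=
  (open Bundle in
  letI : Bundle.RiemannianBundle (fun x : M ↦ TangentSpace (𝓡 n) x) :=
    ⟨h.toContinuousRiemannianMetric.toRiemannianMetric⟩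
  (∀ a b : M, |InnerProductGeometry.angle (f a : EuclideanSpace ℝ (Fin (n + 1))) (f b) -
      (Manifold.riemannianEDist (𝓡 n) a b).toReal| ≤ ε) ∧
    ∀ y : Metric.sphere (0 : EuclideanSpace ℝ (Fin (n + 1))) 1, ∃ a : M,
      InnerProductGeometry.angle (f a : EuclideanSpace ℝ (Fin (n + 1))) y ≤ ε)

/-- **Colding 1996, *Shape of manifolds with positive Ricci curvature*, Main Theorem (NAMED FACT,
not proved here).** Printed (Zbl 0871.53027): "Given an integer `n ≥ 2` and `ε > 0`, there exists
`δ = δ(n, ε) > 0` such that if `M` is an `n`-dimensional closed Riemannian manifold with `Ric ≥ n − 1`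
and `Vol(M) ≥ Vol(Sⁿ) − δ`, then the Gromov–Hausdorff distance between `M` and `Sⁿ` is at most `ε`."
(Quoted as [24] in Cheeger–Colding 1997, p. 459.) Tree form, in the binders of
`CheegerColding1997_thmA110`: for `n ≥ 2` and `ε > 0` there is `δ > 0` such that every compact
connected `C^∞` `n`-manifold `M` with a `C^∞` Riemannian metric `h`, `Ric_h ≥ (n − 1) h` and
`riemannianMeasure h univ ≥ (1 − δ)|Sⁿ|` (`|Sⁿ| = unitSphereVolume n`) admits an
`ε`-Gromov–Hausdorff approximation to the unit round sphere (`IsRoundSphereGHApprox`). Volume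
threshold multiplicative and `d_GH` through approximations: equivalent to print up to
reparametrising `δ` and `ε`. First child of the decomposition of `CheegerColding1997_thmA110`.
[cite: Colding1996Shape, Main Theorem] -/
def Colding1996_volume_ghClose : Prop :=
  ∀ n : ℕ, 2 ≤ n → ∀ ε : ℝ, 0 < ε → ∃ δ : ℝ, 0 < δ ∧
    ∀ (M : Type) [TopologicalSpace M] [T2Space M] [SecondCountableTopology M]
      [ChartedSpace (EuclideanSpace ℝ (Fin n)) M] [IsManifold (𝓡 n) ∞ M] [CompactSpace M]
      [ConnectedSpace M] [MeasurableSpace M] [BorelSpace M]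
      (h : Bundle.ContMDiffRiemannianMetric (𝓡 n) ∞ (EuclideanSpace ℝ (Fin n))
        (TangentSpace (𝓡 n) : M → Type _))
      [(PseudoRiemannianMetric.ofRiemannian h).HasLeviCivita],
      (∀ (x : M) (v : TangentSpace (𝓡 n) x),
          ((n : ℝ) - 1) * h.inner x v v ≤ (PseudoRiemannianMetric.ofRiemannian h).ricci x v v) →
        ENNReal.ofReal ((1 - δ) * unitSphereVolume n) ≤ riemannianMeasure h Set.univ →
          ∃ f : M → Metric.sphere (0 : EuclideanSpace ℝ (Fin (n + 1))) 1,
            IsRoundSphereGHApprox n h ε f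

/-- **Cheeger–Colding 1997, Thm A.1.12 at the round sphere, `ε`-form (NAMED FACT, not proved here).**
Printed (p. 459): "Let the compact smooth Riemannian manifold, `Mⁿ`, be the Gromov–Hausdorff limit of
a sequence, `{M_iⁿ}`, satisfying (1.1) [`Ric_{M_iⁿ} ≥ −(n − 1)`]. Then `M_iⁿ` is diffeomorphic to
`Mⁿ`, for all `i` sufficiently large" (proved by the intrinsic Reifenberg method, Thms A.1.1–A.1.3,
A.1.8–A.1.9, with the volume convergence Thm A.1.5 = Colding 1997). Tree form, at `Mⁿ = Sⁿ` the unit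
round sphere and by contradiction along `εᵢ = 1/i`: for `n ≥ 2` there is `ε > 0` such that every
compact connected `C^∞` `n`-manifold `M` with a `C^∞` Riemannian metric `h`, `Ric_h ≥ −(n − 1) h`,
admitting an `ε`-Gromov–Hausdorff approximation to the unit round sphere (`IsRoundSphereGHApprox`) is
`C^∞`-diffeomorphic to `Sⁿ ⊂ ℝⁿ⁺¹`. This is the theorem that "plays the role of Perelman's theorem"
in the proof of Thm A.1.10 (p. 459). Second child of the decomposition of `CheegerColding1997_thmA110`.
[cite: CheegerColding1997, Appendix 1 Thm A.1.12 (p. 459), at Mⁿ = Sⁿ] -/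
def CheegerColding1997_sphereStability : Prop :=
  ∀ n : ℕ, 2 ≤ n → ∃ ε : ℝ, 0 < ε ∧
    ∀ (M : Type) [TopologicalSpace M] [T2Space M] [SecondCountableTopology M]
      [ChartedSpace (EuclideanSpace ℝ (Fin n)) M] [IsManifold (𝓡 n) ∞ M] [CompactSpace M]
      [ConnectedSpace M] [MeasurableSpace M] [BorelSpace M]
      (h : Bundle.ContMDiffRiemannianMetric (𝓡 n) ∞ (EuclideanSpace ℝ (Fin n))
        (TangentSpace (𝓡 n) : M → Type _))
      [(PseudoRiemannianMetric.ofRiemannian h).HasLeviCivita],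
      (∀ (x : M) (v : TangentSpace (𝓡 n) x),
          -((n : ℝ) - 1) * h.inner x v v ≤ (PseudoRiemannianMetric.ofRiemannian h).ricci x v v) →
        (∃ f : M → Metric.sphere (0 : EuclideanSpace ℝ (Fin (n + 1))) 1,
            IsRoundSphereGHApprox n h ε f) →
          Nonempty (M ≃ₘ⟮𝓡 n, 𝓡 n⟯ Metric.sphere (0 : EuclideanSpace ℝ (Fin (n + 1))) 1)

/-- **Assembly of the decomposition (the printed proof of Thm A.1.10, p. 459: "arguing as in [24],
[25] … letting Theorem A.1.8 [here A.1.12] play the role of Perelman's theorem").** Colding's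
"almost maximal volume ⟹ Gromov–Hausdorff close to `Sⁿ`" and the sphere stability theorem give the
differentiable volume sphere theorem `CheegerColding1997_thmA110`: choose `ε(n)` from the stability
theorem and `δ(n) = δ(n, ε(n))` from Colding's theorem; `Ric ≥ (n − 1)h ≥ −(n − 1)h` since `h ≥ 0`
and `n ≥ 2`. [cite: CheegerColding1997, Appendix 1 Thm A.1.10 (p. 459), proof] -/
theorem CheegerColding1997_thmA110_holds_of (hA : Colding1996_volume_ghClose)
    (hB : CheegerColding1997_sphereStability) : CheegerColding1997_thmA110 := by
  intro n hn
  obtain ⟨ε, hε, HB⟩ := hB n hn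
  obtain ⟨δ, hδ, HA⟩ := hA n hn ε hε
  refine ⟨δ, hδ, ?_⟩
  intro M _ _ _ _ _ _ _ _ _ h _ hRic hVol
  have hn1 : (0 : ℝ) ≤ (n : ℝ) - 1 := by
    have h2 : (2 : ℝ) ≤ n := by exact_mod_cast hn
    linarith
  refine HB M h (fun x v => ?_) (HA M h hRic hVol)
  have h0 : 0 ≤ h.inner x v v := by
    by_cases hv : v = 0
    · subst hv
      simp
    · exact (h.pos x v hv).le
  calc -((n : ℝ) - 1) * h.inner x v v ≤ ((n : ℝ) - 1) * h.inner x v v := by nlinarith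
    _ ≤ (PseudoRiemannianMetric.ofRiemannian h).ricci x v v := hRic x v

end Literature.Geometry.Riemannian

end
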